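import Literature.Analysis.FluidPDE.ElgindiBlockPairing
import Literature.Analysis.FluidPDE.ElgindiCutoffCalculus
import Literature.Analysis.FluidPDE.ElgindiCommutatorCalculus
import Literature.Analysis.FluidPDE.ElgindiWordCalculus
import HarnessLib

/-!
# Calculus of the `Λ`-scaled `𝓗¹`-blocks: linearity, locality, and the Cauchy–Schwarz bounds for
radial-multiplier and separable left factors ([Elgindi2021] §6.3, proof of Proposition 6.13)

Topic `Literature/Analysis/FluidPDE`. Proof file (everything proved, no definitions, no named
facts) on the proof path of the named fact
`Literature.Analysis.FluidPDE.Elgindi.ElgindiGhoulMasmoudi2021_stabilityCore`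
(`ElgindiStabilityDecomposition.lean`). T. M. Elgindi, Ann. of Math. 194 (2021) =
arXiv:1904.04795, §6.3 proof of Proposition 6.13: the pairing `(E, D_θf)_{𝓗^{k−1}}` of an error
term against a word of `f` is split along the decomposition of `E` and each piece is bounded by
Cauchy–Schwarz ("`≥ c_{k−1}|D_θf|² − C_{k−1}|E₁|_{𝓗^{k−1}}|D_θf|_{𝓗^{k−1}}`").

For the `Λ`-scaled block `blockΛ α Λ v u` (`ElgindiBlockPairing.lean`) this file proves: locality and
linearity in `v` (`v`'s of class `C¹` on the open strip, `u ∈ C¹` compactly supported inside it),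
and the two bounds
`|blockΛ(m·g, u)| ≤ 10(M'√X_g + M√Z_g)√Z_u + Λ(10¹⁰M√X_g√X_u + 10¹⁷M√A_g√A_u + 10²¹M√Y_g√Y_u)`
(`|m| ≤ M`, `|D_zm| ≤ M'` on `z > 0`) and
`|blockΛ(S⊗G, u)| ≤ 10√(I(D_zS)J_η(G))√Z_u + Λ(10¹⁰√(I(S)J_η(G))√X_u + 10¹⁷√(I(S)J_1(G))√A_u +
10²¹√(I(S)J_γ(D_θG))√Y_u)` (`I(S) = ∫₀^∞S²w²`, `J_ρ(G) = ∫₀^{π/2}G²ρ`), where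
`X = sqW_η`, `Z = sqW_η∘D_z`, `A = sqW_1`, `Y = sqW_γ∘D_θ`.
-/

noncomputable section

open MeasureTheory Set Function Real Filter
open _root_.Topology

namespace Literature.Analysis.FluidPDE

namespace Elgindi

/-! ### Test functions of class `C¹` and their first derivatives -/

/-- `D_z u` of a `C¹` test function: continuous, compactly supported inside the strip. [folklore] -/
theorem test_Dz {u : ℝ → ℝ → ℝ} (hu : ContDiff ℝ 1 (uncurry u)) (hs : HasCompactSupport (uncurry u))
    (hsub : tsupport (uncurry u) ⊆ strip) :
    Continuous (uncurry (Dz u)) ∧ HasCompactSupport (uncurry (Dz u)) ∧ tsupport (uncurry (Dz u)) ⊆ strip :=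
  ⟨(continuous_fst.mul (continuous_dz hu)).congr fun p => by simp [Function.uncurry, Dz_eq_mul_dz],
    hasCompactSupport_Dz hs, tsupport_Dz_subset.trans hsub⟩

/-- `D_θ u` of a `C¹` test function: continuous, compactly supported inside the strip. [folklore] -/
theorem test_Dθ {u : ℝ → ℝ → ℝ} (hu : ContDiff ℝ 1 (uncurry u)) (hs : HasCompactSupport (uncurry u))
    (hsub : tsupport (uncurry u) ⊆ strip) :
    Continuous (uncurry (Dθ u)) ∧ HasCompactSupport (uncurry (Dθ u)) ∧ tsupport (uncurry (Dθ u)) ⊆ strip :=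
  ⟨continuous_Dθ hu, hasCompactSupport_Dθ hs, tsupport_Dθ_subset.trans hsub⟩

/-! ### Locality and linearity of the block in the left slot -/

/-- `blockΛ` only sees the values of `v` on the open strip. [folklore] -/
theorem blockΛ_congr_left {α Λ : ℝ} {v₁ v₂ : ℝ → ℝ → ℝ} (h : ∀ p ∈ strip, v₁ p.1 p.2 = v₂ p.1 p.2)
    (u : ℝ → ℝ → ℝ) : blockΛ α Λ v₁ u = blockΛ α Λ v₂ u := by
  rw [blockΛ_def, blockΛ_def, pairW_congr_left h, pairW_congr_left h, pairW_congr_left (fun p hp => Dz_congr h hp),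
    pairW_congr_left (fun p hp => Dθ_congr h hp)]

/-- **Additivity of `blockΛ` in `v`** for `v₁, v₂ ∈ C¹(strip)` and a `C¹` test function `u`. [folklore] -/
theorem blockΛ_add_left {α Λ : ℝ} {v₁ v₂ : ℝ → ℝ → ℝ} (hv₁ : ContDiffOn ℝ 1 (uncurry v₁) strip)
    (hv₂ : ContDiffOn ℝ 1 (uncurry v₂) strip) {u : ℝ → ℝ → ℝ} (hu : ContDiff ℝ 1 (uncurry u))
    (hs : HasCompactSupport (uncurry u)) (hsub : tsupport (uncurry u) ⊆ strip) :
    blockΛ α Λ (v₁ + v₂) u = blockΛ α Λ v₁ u + blockΛ α Λ v₂ u := by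
  obtain ⟨hzc, hzs, hzsub⟩ := test_Dz hu hs hsub
  obtain ⟨hθc, hθs, hθsub⟩ := test_Dθ hu hs hsub
  have c1 : ContinuousOn (uncurry v₁) strip := hv₁.continuousOn
  have c2 : ContinuousOn (uncurry v₂) strip := hv₂.continuousOn
  have cz1 : ContinuousOn (uncurry (Dz v₁)) strip := (contDiffOn_Dz (n := 0) (by exact_mod_cast hv₁)).continuousOn
  have cz2 : ContinuousOn (uncurry (Dz v₂)) strip := (contDiffOn_Dz (n := 0) (by exact_mod_cast hv₂)).continuousOn
  have cθ1 : ContinuousOn (uncurry (Dθ v₁)) strip := (contDiffOn_Dθ (n := 0) (by exact_mod_cast hv₁)).continuousOn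
  have cθ2 : ContinuousOn (uncurry (Dθ v₂)) strip := (contDiffOn_Dθ (n := 0) (by exact_mod_cast hv₂)).continuousOn
  have ez : ∀ p ∈ strip, Dz (v₁ + v₂) p.1 p.2 = (Dz v₁ + Dz v₂) p.1 p.2 := fun p hp => by
    rw [Dz_add_apply (differentiableAt_of_contDiffOn_strip hv₁ one_ne_zero hp)
      (differentiableAt_of_contDiffOn_strip hv₂ one_ne_zero hp)]
    rfl
  have eθ : ∀ p ∈ strip, Dθ (v₁ + v₂) p.1 p.2 = (Dθ v₁ + Dθ v₂) p.1 p.2 := fun p hp => by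
    rw [Dθ_add_apply (differentiableAt_of_contDiffOn_strip hv₁ one_ne_zero hp)
      (differentiableAt_of_contDiffOn_strip hv₂ one_ne_zero hp)]
    rfl
  rw [blockΛ_def, blockΛ_def, blockΛ_def, pairW_congr_left ez, pairW_congr_left eθ,
    pairW_add_left isWeight_wEta cz1 cz2 hzc hzs hzsub, pairW_add_left isWeight_wEta c1 c2 hu.continuous hs hsub,
    pairW_add_left isWeight_one c1 c2 hu.continuous hs hsub, pairW_add_left (isWeight_wGam α) cθ1 cθ2 hθc hθs hθsub]
  ring

/-- Homogeneity of `blockΛ` in `v`. [folklore] -/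
theorem blockΛ_smul_left (α Λ a : ℝ) (v u : ℝ → ℝ → ℝ) : blockΛ α Λ (a • v) u = a * blockΛ α Λ v u := by
  rw [blockΛ_def, blockΛ_def, Dz_smul, Dθ_smul, pairW_smul_left, pairW_smul_left, pairW_smul_left, pairW_smul_left]
  ring

/-- `blockΛ` of a difference. [folklore] -/
theorem blockΛ_sub_left {α Λ : ℝ} {v₁ v₂ : ℝ → ℝ → ℝ} (hv₁ : ContDiffOn ℝ 1 (uncurry v₁) strip)
    (hv₂ : ContDiffOn ℝ 1 (uncurry v₂) strip) {u : ℝ → ℝ → ℝ} (hu : ContDiff ℝ 1 (uncurry u))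
    (hs : HasCompactSupport (uncurry u)) (hsub : tsupport (uncurry u) ⊆ strip) :
    blockΛ α Λ (v₁ - v₂) u = blockΛ α Λ v₁ u - blockΛ α Λ v₂ u := by
  have hv₂' : ContDiffOn ℝ 1 (uncurry ((-1 : ℝ) • v₂)) strip :=
    (hv₂.const_smul (-1 : ℝ)).congr fun q _ => by simp [Function.uncurry]
  have e : v₁ - v₂ = v₁ + (-1 : ℝ) • v₂ := by funext z θ; simp [sub_eq_add_neg]
  rw [e, blockΛ_add_left hv₁ hv₂' hu hs hsub, blockΛ_smul_left]
  ring

/-- **`blockΛ` of a finite sum** of `C¹(strip)` left factors. [folklore] -/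
theorem blockΛ_sum_left {α Λ : ℝ} {ι : Type*} (s : Finset ι) {v : ι → ℝ → ℝ → ℝ}
    (hv : ∀ k ∈ s, ContDiffOn ℝ 1 (uncurry (v k)) strip) {u : ℝ → ℝ → ℝ} (hu : ContDiff ℝ 1 (uncurry u))
    (hs : HasCompactSupport (uncurry u)) (hsub : tsupport (uncurry u) ⊆ strip) :
    blockΛ α Λ (∑ k ∈ s, v k) u = ∑ k ∈ s, blockΛ α Λ (v k) u := by
  classical
  induction s using Finset.induction_on with
  | empty =>
    simp only [Finset.sum_empty]
    rw [blockΛ_def]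
    simp [pairW_def, Dz_zero, Dθ_zero]
  | insert a s ha ih =>
    have hvs : ∀ k ∈ s, ContDiffOn ℝ 1 (uncurry (v k)) strip := fun k hk => hv k (Finset.mem_insert_of_mem hk)
    have hsum : ContDiffOn ℝ 1 (uncurry (∑ k ∈ s, v k)) strip := contDiffOn_finset_sum s hvs
    rw [Finset.sum_insert ha, Finset.sum_insert ha, blockΛ_add_left (hv a (Finset.mem_insert_self a s)) hsum hu hs hsub,
      ih hvs]

/-! ### From squared bounds to bounds -/

/-- `T² ≤ P·Q` with `P, Q ≥ 0` gives `|T| ≤ √P·√Q`. [folklore] -/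
theorem abs_le_sqrt_mul_sqrt {T P Q : ℝ} (hP : 0 ≤ P) (h : T ^ 2 ≤ P * Q) : |T| ≤ Real.sqrt P * Real.sqrt Q := by
  rw [← Real.sqrt_mul hP]
  exact Real.abs_le_sqrt h

/-- `T² ≤ M²·P·Q` with `M, P ≥ 0` gives `|T| ≤ M·√P·√Q`. [folklore] -/
theorem abs_le_mul_sqrt_mul_sqrt {T M P Q : ℝ} (hM : 0 ≤ M) (hP : 0 ≤ P) (h : T ^ 2 ≤ M ^ 2 * P * Q) :
    |T| ≤ M * Real.sqrt P * Real.sqrt Q := by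
  have h' : T ^ 2 ≤ (M ^ 2 * P) * Q := by simpa [mul_assoc] using h
  have := abs_le_sqrt_mul_sqrt (by positivity) h'
  rwa [Real.sqrt_mul (sq_nonneg _), Real.sqrt_sq hM] at this

/-! ### The bound for a radial-multiplier left factor -/

/-- **`|blockΛ(m·g, u)|` for a bounded radial multiplier**: `m ∈ C¹(0,∞)` with `|m| ≤ M`,
`|D_zm| ≤ M'` there, `g ∈ C²` and `u ∈ C¹` test functions, `Λ ≥ 0`:
`|blockΛ α Λ (m·g) u| ≤ 10(M'√X_g + M√Z_g)√Z_u + Λ(10¹⁰M√X_g√X_u + 10¹⁷M√A_g√A_u + 10²¹M√Y_g√Y_u)`. [cite: Elgindi2021, §6.3 proof of Proposition 6.13 (p. 18 of arXiv:1904.04795)] -/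
theorem abs_blockΛ_radialMul_le {α Λ : ℝ} (hΛ : 0 ≤ Λ) {m : ℝ → ℝ} {M M' : ℝ} (hM0 : 0 ≤ M) (hM'0 : 0 ≤ M')
    (hm : ContDiffOn ℝ 1 m (Ioi 0)) (hM : ∀ z ∈ Ioi (0 : ℝ), |m z| ≤ M) (hM' : ∀ z ∈ Ioi (0 : ℝ), |Dz₁ m z| ≤ M')
    {g : ℝ → ℝ → ℝ} (hg : ContDiff ℝ 2 (uncurry g)) (hgs : HasCompactSupport (uncurry g))
    (hgsub : tsupport (uncurry g) ⊆ strip) {u : ℝ → ℝ → ℝ} (hu : ContDiff ℝ 1 (uncurry u))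
    (hs : HasCompactSupport (uncurry u)) (hsub : tsupport (uncurry u) ⊆ strip) :
    |blockΛ α Λ (radialMul m g) u| ≤
      10 * (M' * Real.sqrt (sqW wEta g) + M * Real.sqrt (sqW wEta (Dz g))) * Real.sqrt (sqW wEta (Dz u))
        + Λ * (10 ^ 10 * M * Real.sqrt (sqW wEta g) * Real.sqrt (sqW wEta u)
          + 10 ^ 17 * M * Real.sqrt (sqW (fun _ => 1) g) * Real.sqrt (sqW (fun _ => 1) u)
          + 10 ^ 21 * M * Real.sqrt (sqW (wGam α) (Dθ g)) * Real.sqrt (sqW (wGam α) (Dθ u))) := by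
  have hg1 : ContDiff ℝ 1 (uncurry g) := hg.of_le (by norm_num)
  obtain ⟨hzc, hzs, hzsub⟩ := test_Dz hu hs hsub
  obtain ⟨hθc, hθs, hθsub⟩ := test_Dθ hu hs hsub
  obtain ⟨gzc, gzs, gzsub⟩ := test_Dz hg1 hgs hgsub
  obtain ⟨gθc, gθs, gθsub⟩ := test_Dθ hg1 hgs hgsub
  have hmc : ContinuousOn m (Ioi 0) := hm.continuousOn
  have hm'c : ContinuousOn (Dz₁ m) (Ioi 0) := (contDiffOn_Dz₁_Ioi (n := 0) (by exact_mod_cast hm)).continuousOn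
  -- `D_z (m g) = (D_z m) g + m D_z g` and `D_θ (m g) = m D_θ g` on the strip
  have ez : ∀ p ∈ strip, Dz (radialMul m g) p.1 p.2 = (radialMul (Dz₁ m) g + radialMul m (Dz g)) p.1 p.2 := by
    intro p hp
    have hmd : DifferentiableAt ℝ m p.1 := (hm.differentiableOn (by simp)).differentiableAt (isOpen_Ioi.mem_nhds hp.1)
    rw [Dz_radialMul_apply hmd ((hg1.differentiable (by simp)) p)]
    simp [radialMul_apply]
  have eθ : Dθ (radialMul m g) = radialMul m (Dθ g) := Dθ_radialMul m g
  -- the four pairings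
  have cR1 : ContinuousOn (uncurry (radialMul (Dz₁ m) g)) strip :=
    ((hm'c.comp continuousOn_fst fun p (hp : p ∈ strip) => hp.1).mul hg.continuous.continuousOn).congr fun p _ => rfl
  have cR2 : ContinuousOn (uncurry (radialMul m (Dz g))) strip :=
    ((hmc.comp continuousOn_fst fun p (hp : p ∈ strip) => hp.1).mul gzc.continuousOn).congr fun p _ => rfl
  have hz : pairW wEta (Dz (radialMul m g)) (Dz u) =
      pairW wEta (radialMul (Dz₁ m) g) (Dz u) + pairW wEta (radialMul m (Dz g)) (Dz u) := by
    rw [pairW_congr_left ez, pairW_add_left isWeight_wEta cR1 cR2 hzc hzs hzsub]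
  have b1 := abs_le_mul_sqrt_mul_sqrt hM'0 (sqW_nonneg isWeight_wEta _)
    (sq_pairW_radialMul_le isWeight_wEta hm'c hM' hg.continuous hgs hgsub hzc hzs hzsub)
  have b2 := abs_le_mul_sqrt_mul_sqrt hM0 (sqW_nonneg isWeight_wEta _)
    (sq_pairW_radialMul_le isWeight_wEta hmc hM gzc gzs gzsub hzc hzs hzsub)
  have b3 := abs_le_mul_sqrt_mul_sqrt hM0 (sqW_nonneg isWeight_wEta _)
    (sq_pairW_radialMul_le isWeight_wEta hmc hM hg.continuous hgs hgsub hu.continuous hs hsub)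
  have b4 := abs_le_mul_sqrt_mul_sqrt hM0 (sqW_nonneg isWeight_one _)
    (sq_pairW_radialMul_le isWeight_one hmc hM hg.continuous hgs hgsub hu.continuous hs hsub)
  have b5 := abs_le_mul_sqrt_mul_sqrt hM0 (sqW_nonneg (isWeight_wGam α) _)
    (sq_pairW_radialMul_le (isWeight_wGam α) hmc hM gθc gθs gθsub hθc hθs hθsub)
  rw [blockΛ_def, hz, eθ]
  have hsZ := Real.sqrt_nonneg (sqW wEta (Dz u))
  calc |10 * (pairW wEta (radialMul (Dz₁ m) g) (Dz u) + pairW wEta (radialMul m (Dz g)) (Dz u)) +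
        Λ * (10 ^ 10 * pairW wEta (radialMul m g) u + 10 ^ 17 * pairW (fun _ => 1) (radialMul m g) u +
          10 ^ 21 * pairW (wGam α) (radialMul m (Dθ g)) (Dθ u))|
      ≤ 10 * (|pairW wEta (radialMul (Dz₁ m) g) (Dz u)| + |pairW wEta (radialMul m (Dz g)) (Dz u)|) +
        Λ * (10 ^ 10 * |pairW wEta (radialMul m g) u| + 10 ^ 17 * |pairW (fun _ => 1) (radialMul m g) u| +
          10 ^ 21 * |pairW (wGam α) (radialMul m (Dθ g)) (Dθ u)|) := by
        refine (abs_add_le _ _).trans (add_le_add ?_ ?_)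
        · rw [abs_mul, abs_of_pos (by norm_num : (0 : ℝ) < 10)]
          exact mul_le_mul_of_nonneg_left (abs_add_le _ _) (by norm_num)
        · rw [abs_mul, abs_of_nonneg hΛ]
          refine mul_le_mul_of_nonneg_left ?_ hΛ
          refine (abs_add_le _ _).trans (add_le_add ((abs_add_le _ _).trans (add_le_add ?_ ?_)) ?_)
          · rw [abs_mul, abs_of_pos (by norm_num : (0 : ℝ) < 10 ^ 10)]
          · rw [abs_mul, abs_of_pos (by norm_num : (0 : ℝ) < 10 ^ 17)]
          · rw [abs_mul, abs_of_pos (by norm_num : (0 : ℝ) < 10 ^ 21)]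
    _ ≤ _ := by nlinarith [b1, b2, b3, b4, b5, hΛ, hsZ]

/-! ### The bound for a separable left factor -/

/-- **`|blockΛ(S⊗G, u)|` for a separable left factor**: `S ∈ C¹(0,∞)`, `G ∈ C¹(0,π/2)` with the
displayed one-dimensional integrals finite (as integrability hypotheses), `u ∈ C¹` test function,
`Λ ≥ 0`: `|blockΛ α Λ (S⊗G) u| ≤ 10√(I(D_zS)J_η(G))√Z_u + Λ(10¹⁰√(I(S)J_η(G))√X_u +
10¹⁷√(I(S)J_1(G))√A_u + 10²¹√(I(S)J_γ(D_θG))√Y_u)`. [cite: Elgindi2021, §6.3 proof of Proposition 6.13 (p. 18 of arXiv:1904.04795)] -/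
theorem abs_blockΛ_tensor_le {α Λ : ℝ} (hΛ : 0 ≤ Λ) {S G : ℝ → ℝ} (hS : ContDiffOn ℝ 1 S (Ioi 0))
    (hG : ContDiffOn ℝ 1 G (Ioo 0 (π / 2)))
    (iS : IntegrableOn (fun z => S z ^ 2 * radialWeight z ^ 2) (Ioi 0))
    (iS' : IntegrableOn (fun z => Dz₁ S z ^ 2 * radialWeight z ^ 2) (Ioi 0))
    (iGη : IntegrableOn (fun θ => G θ ^ 2 * wEta θ) (Ioo 0 (π / 2)))
    (iG1 : IntegrableOn (fun θ => G θ ^ 2 * (1 : ℝ)) (Ioo 0 (π / 2)))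
    (iGγ : IntegrableOn (fun θ => Dθ₁ G θ ^ 2 * wGam α θ) (Ioo 0 (π / 2)))
    {u : ℝ → ℝ → ℝ} (hu : ContDiff ℝ 1 (uncurry u)) (hs : HasCompactSupport (uncurry u))
    (hsub : tsupport (uncurry u) ⊆ strip) :
    |blockΛ α Λ (tensor S G) u| ≤
      10 * Real.sqrt ((∫ z in Ioi 0, Dz₁ S z ^ 2 * radialWeight z ^ 2) * ∫ θ in Ioo 0 (π / 2), G θ ^ 2 * wEta θ) *
          Real.sqrt (sqW wEta (Dz u))
        + Λ * (10 ^ 10 * Real.sqrt ((∫ z in Ioi 0, S z ^ 2 * radialWeight z ^ 2) * ∫ θ in Ioo 0 (π / 2), G θ ^ 2 * wEta θ) *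
              Real.sqrt (sqW wEta u)
          + 10 ^ 17 * Real.sqrt ((∫ z in Ioi 0, S z ^ 2 * radialWeight z ^ 2) * ∫ θ in Ioo 0 (π / 2), G θ ^ 2 * (1 : ℝ)) *
              Real.sqrt (sqW (fun _ => 1) u)
          + 10 ^ 21 * Real.sqrt ((∫ z in Ioi 0, S z ^ 2 * radialWeight z ^ 2) * ∫ θ in Ioo 0 (π / 2), Dθ₁ G θ ^ 2 * wGam α θ) *
              Real.sqrt (sqW (wGam α) (Dθ u))) := by
  obtain ⟨hzc, hzs, hzsub⟩ := test_Dz hu hs hsub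
  obtain ⟨hθc, hθs, hθsub⟩ := test_Dθ hu hs hsub
  have hSc : ContinuousOn S (Ioi 0) := hS.continuousOn
  have hS'c : ContinuousOn (Dz₁ S) (Ioi 0) := (contDiffOn_Dz₁_Ioi (n := 0) (by exact_mod_cast hS)).continuousOn
  have hGc : ContinuousOn G (Ioo 0 (π / 2)) := hG.continuousOn
  have hG'c : ContinuousOn (Dθ₁ G) (Ioo 0 (π / 2)) := (contDiffOn_Dθ₁_Ioo (n := 0) (by exact_mod_cast hG)).continuousOn
  have hI0 : 0 ≤ ∫ z in Ioi 0, S z ^ 2 * radialWeight z ^ 2 :=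
    setIntegral_nonneg measurableSet_Ioi fun z _ => mul_nonneg (sq_nonneg _) (sq_nonneg _)
  have hI0' : 0 ≤ ∫ z in Ioi 0, Dz₁ S z ^ 2 * radialWeight z ^ 2 :=
    setIntegral_nonneg measurableSet_Ioi fun z _ => mul_nonneg (sq_nonneg _) (sq_nonneg _)
  have b1 := abs_le_sqrt_mul_sqrt (mul_nonneg hI0' (setIntegral_nonneg measurableSet_Ioo fun θ hθ =>
      mul_nonneg (sq_nonneg _) (isWeight_wEta.nonneg θ hθ)))
    (sq_pairW_tensor_le isWeight_wEta hS'c iS' hGc iGη hzc hzs hzsub)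
  have b2 := abs_le_sqrt_mul_sqrt (mul_nonneg hI0 (setIntegral_nonneg measurableSet_Ioo fun θ hθ =>
      mul_nonneg (sq_nonneg _) (isWeight_wEta.nonneg θ hθ)))
    (sq_pairW_tensor_le isWeight_wEta hSc iS hGc iGη hu.continuous hs hsub)
  have b3 := abs_le_sqrt_mul_sqrt (mul_nonneg hI0 (setIntegral_nonneg measurableSet_Ioo fun θ _ =>
      mul_nonneg (sq_nonneg _) zero_le_one))
    (sq_pairW_tensor_le isWeight_one hSc iS hGc iG1 hu.continuous hs hsub)
  have b4 := abs_le_sqrt_mul_sqrt (mul_nonneg hI0 (setIntegral_nonneg measurableSet_Ioo fun θ hθ =>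
      mul_nonneg (sq_nonneg _) ((isWeight_wGam α).nonneg θ hθ)))
    (sq_pairW_tensor_le (isWeight_wGam α) hSc iS hG'c iGγ hθc hθs hθsub)
  rw [blockΛ_def, Dz_tensor, Dθ_tensor]
  calc |10 * pairW wEta (tensor (Dz₁ S) G) (Dz u) +
        Λ * (10 ^ 10 * pairW wEta (tensor S G) u + 10 ^ 17 * pairW (fun _ => 1) (tensor S G) u +
          10 ^ 21 * pairW (wGam α) (tensor S (Dθ₁ G)) (Dθ u))|
      ≤ 10 * |pairW wEta (tensor (Dz₁ S) G) (Dz u)| +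
        Λ * (10 ^ 10 * |pairW wEta (tensor S G) u| + 10 ^ 17 * |pairW (fun _ => 1) (tensor S G) u| +
          10 ^ 21 * |pairW (wGam α) (tensor S (Dθ₁ G)) (Dθ u)|) := by
        refine (abs_add_le _ _).trans (add_le_add ?_ ?_)
        · rw [abs_mul, abs_of_pos (by norm_num : (0 : ℝ) < 10)]
        · rw [abs_mul, abs_of_nonneg hΛ]
          refine mul_le_mul_of_nonneg_left ?_ hΛ
          refine (abs_add_le _ _).trans (add_le_add ((abs_add_le _ _).trans (add_le_add ?_ ?_)) ?_)
          · rw [abs_mul, abs_of_pos (by norm_num : (0 : ℝ) < 10 ^ 10)]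
          · rw [abs_mul, abs_of_pos (by norm_num : (0 : ℝ) < 10 ^ 17)]
          · rw [abs_mul, abs_of_pos (by norm_num : (0 : ℝ) < 10 ^ 21)]
    _ ≤ _ := by nlinarith [b1, b2, b3, b4, hΛ]

end Elgindi

end Literature.Analysis.FluidPDE
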